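import Summits.KontsevichZagierPeriods.KontsevichZagierPeriods.Theorems.EllipticMomentKernel.Negative.LoadBearing
import Literature.NumberTheory.Transcendental.SemialgebraicMapsProofs

/-!
# `EllipticMomentKernel` (stmt-KontsevichZagierPeriods-10631) — negative knowledge, part 3: honest generators on the model curve `y² = 4x³ − 4x`

On `(q₂, q₃) = (4, 0)` (roots `−1, 0, 1`, `σ = (−1, 0)`): `oval_four_zero`, semialgebraicity of the
oval and of the integrands `x^m/√f` (tree API: `isSemialgebraicFunOn_aeval_div_aeval`,
`IsSemialgebraicFunOn.sqrt_holds`, `.mul_holds`), absolute integrability of `x^m/√f` on the oval by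
domination with `½·d/dx arcsin(2x+1)` (`integrableOn_genIntegrand`), the honest representations
`genRep m : IntegralRep 1 ∈ gens₁ 4 0` (so the generator set of the crux is inhabited), and their
values / windowed values as interval integrals (`value_genRep`, `setIntegral_genRep_inter`).
[folklore]
-/

noncomputable section

open MeasureTheory Set
open scoped BigOperators

namespace Summit.KontsevichZagierPeriods.HermiteRigidity.EllipticMomentKernelNegative

open Literature.NumberTheory.Transcendental
open Literature.NumberTheory.Transcendental.KZ
open Summit.KontsevichZagierPeriods.KontsevichZagierPeriods.Theses.HermiteRigidity (EllipticMomentKernel)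

section ModelCurve

open Literature.ModelTheory.ExponentialFields (IsSemialgebraic isSemialgebraic_setOf_eval_pos)
open MvPolynomial (aeval X C)

/-- The model cubic. [folklore] -/
theorem cubic_four_zero (x : ℝ) : cubic 4 0 x = 4 * x ^ 3 - 4 * x := by
  unfold cubic; push_cast; ring

/-- Its discriminant is `64 > 0`. [folklore] -/
theorem disc_four_zero : disc 4 0 = 64 := by
  unfold disc; norm_num

/-- On the model curve the oval is literally the interval `(−1, 0)`. [folklore] -/
theorem oval_four_zero : oval 4 0 = {p | -1 < p 0 ∧ p 0 < 0} := by
  ext p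
  simp only [oval, mem_setOf_eq, cubic_four_zero]
  constructor
  · rintro ⟨hpos, t, hpt, hft⟩
    have hx : 0 < p 0 * (p 0 - 1) * (p 0 + 1) := by nlinarith
    have ht' : t * (t - 1) * (t + 1) < 0 := by nlinarith
    by_contra hcon
    have hx1 : 1 < p 0 := by
      by_contra h1
      push Not at h1
      rcases not_and_or.mp hcon with h | h
      · push Not at h
        have : p 0 * (p 0 - 1) * (p 0 + 1) ≤ 0 :=
          mul_nonpos_of_nonneg_of_nonpos (mul_nonneg_of_nonpos_of_nonpos (by linarith) (by linarith))
            (by linarith)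
        linarith
      · push Not at h
        have : p 0 * (p 0 - 1) * (p 0 + 1) ≤ 0 :=
          mul_nonpos_of_nonpos_of_nonneg (mul_nonpos_of_nonneg_of_nonpos h (by linarith)) (by linarith)
        linarith
    have : 0 < t * (t - 1) * (t + 1) := by
      have h1 : 0 < t := by linarith
      have h2 : 0 < t - 1 := by linarith
      have h3 : 0 < t + 1 := by linarith
      positivity
    linarith
  · rintro ⟨h1, h2⟩
    refine ⟨?_, 1 / 2, by linarith, by norm_num⟩
    have : 0 < (-p 0) * (1 - p 0) * (p 0 + 1) := by
      have h3 : 0 < -p 0 := by linarith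
      have h4 : 0 < 1 - p 0 := by linarith
      have h5 : 0 < p 0 + 1 := by linarith
      positivity
    nlinarith

/-- The oval of the model curve is `ℚ`-semialgebraic (quantifier-free: `{0 < x + 1} ∩ {0 < −x}`).
[folklore] -/
theorem isSemialgebraic_oval_four_zero : IsSemialgebraic ℚ (oval 4 0) := by
  rw [oval_four_zero]
  have h1 := isSemialgebraic_setOf_eval_pos (k := ℚ) (R := ℝ) (X 0 + 1 : MvPolynomial (Fin 1) ℚ)
  have h2 := isSemialgebraic_setOf_eval_pos (k := ℚ) (R := ℝ) (-X 0 : MvPolynomial (Fin 1) ℚ)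
  convert h1.inter h2 using 1
  ext p
  simp only [mem_setOf_eq, mem_inter_iff, map_add, map_one, MvPolynomial.aeval_X, map_neg]
  constructor
  · rintro ⟨h1, h2⟩; exact ⟨by linarith, by linarith⟩
  · rintro ⟨h1, h2⟩; exact ⟨by linarith, by linarith⟩

/-- The model cubic as a `ℚ`-polynomial in `X 0`. [folklore] -/
def cubicPoly : MvPolynomial (Fin 1) ℚ := 4 * X 0 ^ 3 - 4 * X 0

/-- Evaluation of `cubicPoly`. [folklore] -/
theorem aeval_cubicPoly (p : Fin 1 → ℝ) : aeval p cubicPoly = cubic 4 0 (p 0) := by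
  simp [cubicPoly, cubic_four_zero, map_ofNat]

/-- The generator integrands `x^m/√f` are `ℚ`-semialgebraic on the oval: `x^m · √(1/f)` with
the tree's `isSemialgebraicFunOn_aeval_div_aeval`, `IsSemialgebraicFunOn.sqrt_holds`,
`IsSemialgebraicFunOn.mul_holds`. [cite: BochnakCosteRoy1998, Prop. 2.2.6] -/
theorem isSemialgebraicFunOn_genIntegrand (m : ℕ) :
    IsSemialgebraicFunOn ℚ (oval 4 0) (fun p => p 0 ^ m / Real.sqrt (cubic 4 0 (p 0))) := by
  have hs := isSemialgebraic_oval_four_zero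
  have h1 : IsSemialgebraicFunOn ℚ (oval 4 0)
      (fun p => aeval p (X 0 ^ m : MvPolynomial (Fin 1) ℚ)) := isSemialgebraicFunOn_aeval hs _
  have h2 : IsSemialgebraicFunOn ℚ (oval 4 0)
      (fun p => aeval p (1 : MvPolynomial (Fin 1) ℚ) / aeval p cubicPoly) :=
    isSemialgebraicFunOn_aeval_div_aeval hs _ _ fun p hp => by
      rw [aeval_cubicPoly]; exact hp.1.ne'
  have h3 := IsSemialgebraicFunOn.sqrt_holds h2
  have h4 := IsSemialgebraicFunOn.mul_holds h1 h3
  refine h4.congr fun p hp => ?_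
  simp only [Pi.mul_apply, map_pow, MvPolynomial.aeval_X, map_one, aeval_cubicPoly]
  rw [Real.sqrt_div' _ hp.1.le, Real.sqrt_one, mul_one_div]

/-! ### Integrability of `x^m/√f` on the oval: comparison with `1/√((−x)(x+1)) = d/dx arcsin(2x+1)` -/

/-- Lower bound `f(x) ≥ 4(−x)(x + 1)` on `(−1, 0)` (`f = 4(−x)(x+1)(1−x)`, `1 − x ≥ 1`). [folklore] -/
theorem cubic_ge_quad {x : ℝ} (hx : x ∈ Ioo (-1 : ℝ) 0) : 4 * (-x * (x + 1)) ≤ cubic 4 0 x := by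
  rw [cubic_four_zero]
  obtain ⟨h1, h2⟩ := hx
  have hq : 0 ≤ -x * (x + 1) := mul_nonneg (by linarith) (by linarith)
  nlinarith

/-- `f > 0` on `(−1, 0)`. [folklore] -/
theorem cubic_pos {x : ℝ} (hx : x ∈ Ioo (-1 : ℝ) 0) : 0 < cubic 4 0 x := by
  obtain ⟨h1, h2⟩ := hx
  have hq : 0 < -x * (x + 1) := mul_pos (by linarith) (by linarith)
  linarith [cubic_ge_quad ⟨h1, h2⟩]

/-- `arcsin (2x + 1)` is a primitive of `1/√((−x)(x+1))` on `(−1, 0)`. [folklore] -/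
theorem hasDerivAt_arcsin_affine {x : ℝ} (hx : x ∈ Ioo (-1 : ℝ) 0) :
    HasDerivAt (fun x => Real.arcsin (2 * x + 1)) (1 / Real.sqrt (-x * (x + 1))) x := by
  obtain ⟨h1, h2⟩ := hx
  have hu1 : 2 * x + 1 ≠ -1 := by intro h; linarith
  have hu2 : 2 * x + 1 ≠ 1 := by intro h; linarith
  have hlin : HasDerivAt (fun x : ℝ => 2 * x + 1) 2 x := by
    simpa using ((hasDerivAt_id x).const_mul 2).add_const 1
  have h := (Real.hasDerivAt_arcsin hu1 hu2).comp x hlin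
  have hsq : Real.sqrt (1 - (2 * x + 1) ^ 2) = 2 * Real.sqrt (-x * (x + 1)) := by
    have : 1 - (2 * x + 1) ^ 2 = 2 ^ 2 * (-x * (x + 1)) := by ring
    rw [this, Real.sqrt_mul (by norm_num : (0 : ℝ) ≤ 2 ^ 2) (-x * (x + 1)),
      Real.sqrt_sq (by norm_num : (0 : ℝ) ≤ 2)]
  have hpos : 0 < Real.sqrt (-x * (x + 1)) := Real.sqrt_pos.2 (mul_pos (by linarith) (by linarith))
  refine h.congr_deriv ?_
  rw [hsq]
  field_simp

/-- `1/√((−x)(x+1))` is integrable on `(−1, 0)`: it is the non-negative derivative of the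
continuous function `arcsin (2x + 1)` (`intervalIntegral.integrableOn_deriv_of_nonneg`), no
improper-integral estimate needed. [folklore] -/
theorem integrableOn_inv_sqrt_quad :
    IntegrableOn (fun x : ℝ => 1 / Real.sqrt (-x * (x + 1))) (Ioo (-1 : ℝ) 0) := by
  have hcont : ContinuousOn (fun x : ℝ => Real.arcsin (2 * x + 1)) (Icc (-1 : ℝ) 0) :=
    (Real.continuous_arcsin.comp (by fun_prop)).continuousOn
  have h := intervalIntegral.integrableOn_deriv_of_nonneg hcont
    (fun x hx => hasDerivAt_arcsin_affine hx) (fun x _ => by positivity)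
  exact h.mono_set Ioo_subset_Ioc_self

/-- Pointwise domination `|x^m/√f| ≤ (1/2)/√((−x)(x+1))` on `(−1, 0)`. [folklore] -/
theorem norm_genIntegrand_le {m : ℕ} {x : ℝ} (hx : x ∈ Ioo (-1 : ℝ) 0) :
    ‖x ^ m / Real.sqrt (cubic 4 0 x)‖ ≤ 1 / 2 * (1 / Real.sqrt (-x * (x + 1))) := by
  obtain ⟨h1, h2⟩ := hx
  have hq : 0 < -x * (x + 1) := mul_pos (by linarith) (by linarith)
  have hf : 0 < cubic 4 0 x := cubic_pos ⟨h1, h2⟩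
  have hsf : 0 < Real.sqrt (cubic 4 0 x) := Real.sqrt_pos.2 hf
  have hsq : 0 < Real.sqrt (-x * (x + 1)) := Real.sqrt_pos.2 hq
  rw [Real.norm_eq_abs, abs_div, abs_of_pos hsf, abs_pow]
  have hxm : |x| ^ m ≤ 1 := pow_le_one₀ (abs_nonneg x) (abs_le.2 ⟨by linarith, by linarith⟩)
  have hsfq : 2 * Real.sqrt (-x * (x + 1)) ≤ Real.sqrt (cubic 4 0 x) := by
    have : 2 * Real.sqrt (-x * (x + 1)) = Real.sqrt (4 * (-x * (x + 1))) := by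
      rw [show (4 : ℝ) = 2 ^ 2 by norm_num, Real.sqrt_mul (by norm_num : (0 : ℝ) ≤ 2 ^ 2) (-x * (x + 1)),
        Real.sqrt_sq (by norm_num : (0 : ℝ) ≤ 2)]
    rw [this]
    exact Real.sqrt_le_sqrt (cubic_ge_quad ⟨h1, h2⟩)
  calc |x| ^ m / Real.sqrt (cubic 4 0 x) ≤ 1 / Real.sqrt (cubic 4 0 x) :=
        div_le_div_of_nonneg_right hxm hsf.le
    _ ≤ 1 / (2 * Real.sqrt (-x * (x + 1))) := one_div_le_one_div_of_le (by positivity) hsfq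
    _ = 1 / 2 * (1 / Real.sqrt (-x * (x + 1))) := by ring

/-- The generator integrands restricted to `ℝ` are continuous on `(−1, 0)`. [folklore] -/
theorem continuousOn_genIntegrand (m : ℕ) :
    ContinuousOn (fun x : ℝ => x ^ m / Real.sqrt (cubic 4 0 x)) (Ioo (-1 : ℝ) 0) := by
  refine ContinuousOn.div (by fun_prop) ?_ fun x hx => (Real.sqrt_pos.2 (cubic_pos hx)).ne'
  exact (Real.continuous_sqrt.comp continuous_cubic).continuousOn

/-- **`x^m/√f` is integrable on `(−1, 0)`** (domination by `(1/2)·d/dx arcsin(2x+1)`). [folklore] -/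
theorem integrableOn_genIntegrand (m : ℕ) :
    IntegrableOn (fun x : ℝ => x ^ m / Real.sqrt (cubic 4 0 x)) (Ioo (-1 : ℝ) 0) := by
  refine Integrable.mono' ((integrableOn_inv_sqrt_quad.const_mul (1 / 2 : ℝ))) ?_ ?_
  · exact (continuousOn_genIntegrand m).aestronglyMeasurable measurableSet_Ioo
  · exact ae_restrict_of_forall_mem measurableSet_Ioo fun x hx => norm_genIntegrand_le hx

/-! ### Transfer to `ℝ¹ = Fin 1 → ℝ` and the honest generators `[σ, x^m/√f]` -/

/-- `ℝ¹ ≃ ℝ`, `p ↦ p 0`. [folklore] -/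
def e1 : (Fin 1 → ℝ) ≃ᵐ ℝ := MeasurableEquiv.funUnique (Fin 1) ℝ

/-- `e1 p = p 0`. [folklore] -/
@[simp] theorem e1_apply (p : Fin 1 → ℝ) : e1 p = p 0 := rfl

/-- `e1` preserves Lebesgue measure. [folklore] -/
theorem measurePreserving_e1 : MeasurePreserving e1 volume volume :=
  volume_preserving_funUnique (Fin 1) ℝ

/-- The oval as a preimage under `e1`. [folklore] -/
theorem oval_eq_preimage : oval 4 0 = e1 ⁻¹' Ioo (-1 : ℝ) 0 := by
  rw [oval_four_zero]; ext p; simp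

/-- Integrability of the generator integrands on the oval in `ℝ¹`. [folklore] -/
theorem integrableOn_genIntegrand_oval (m : ℕ) :
    IntegrableOn (fun p : Fin 1 → ℝ => p 0 ^ m / Real.sqrt (cubic 4 0 (p 0))) (oval 4 0) := by
  rw [oval_eq_preimage]
  exact (measurePreserving_e1.integrableOn_comp_preimage e1.measurableEmbedding).mpr
    (integrableOn_genIntegrand m)

/-- **The honest generator `[σ, x^m/√f]` of the model sector** (domain, integrand, both
semialgebraicity certificates and absolute integrability supplied): the set `gens₁ 4 0` — hence
`S` of the crux at `(q₂, q₃) = (4, 0)` — is inhabited, so the crux is not trivially true for want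
of representations. [cite: KontsevichZagier2001, §1.1] -/
def genRep (m : ℕ) : IntegralRep 1 where
  domain := oval 4 0
  integrand := fun p => p 0 ^ m / Real.sqrt (cubic 4 0 (p 0))
  isSemialgebraic_domain := isSemialgebraic_oval_four_zero
  isSemialgebraicFunOn_integrand := isSemialgebraicFunOn_genIntegrand m
  integrableOn := integrableOn_genIntegrand_oval m

/-- `[genRep m] ∈ gens₁ 4 0`. [folklore] -/
theorem of_genRep_mem_gens₁ (m : ℕ) : KZ.of (genRep m) ∈ gens₁ 4 0 :=
  ⟨genRep m, m, rfl, fun _ _ => rfl, rfl⟩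

/-- `[genRep m] ∈ gens 4 0`. [folklore] -/
theorem of_genRep_mem_gens (m : ℕ) : KZ.of (genRep m) ∈ gens 4 0 :=
  Or.inr (of_genRep_mem_gens₁ m)

/-- Non-vacuity of the generator set of the crux on the model curve. [folklore] -/
theorem gens_four_zero_nonempty : (gens 4 0).Nonempty := ⟨_, of_genRep_mem_gens 0⟩

/-- The value of `genRep m` as an interval integral `J_m = ∫_{-1}^{0} x^m dx/√f`. [folklore] -/
theorem value_genRep (m : ℕ) :
    (genRep m).value = ∫ x in (-1 : ℝ)..0, x ^ m / Real.sqrt (cubic 4 0 x) := by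
  unfold IntegralRep.value
  have key := measurePreserving_e1.setIntegral_preimage_emb e1.measurableEmbedding
    (fun x : ℝ => x ^ m / Real.sqrt (cubic 4 0 x)) (Ioo (-1 : ℝ) 0)
  simp only [e1_apply] at key
  rw [show (genRep m).domain = e1 ⁻¹' Ioo (-1 : ℝ) 0 from oval_eq_preimage]
  change ∫ p in e1 ⁻¹' Ioo (-1 : ℝ) 0, p 0 ^ m / Real.sqrt (cubic 4 0 (p 0)) = _
  rw [key, intervalIntegral.integral_of_le (by norm_num), integral_Ioc_eq_integral_Ioo]

/-- Restricted value of `genRep m` over a window `(−1, w)`, `−1 ≤ w ≤ 0`. [folklore] -/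
theorem setIntegral_genRep_inter (m : ℕ) {w : ℝ} (hw1 : -1 ≤ w) (hw0 : w ≤ 0) :
    ∫ p in (genRep m).domain ∩ {p | p 0 < w}, (genRep m).integrand p =
      ∫ x in (-1 : ℝ)..w, x ^ m / Real.sqrt (cubic 4 0 x) := by
  have hset : (genRep m).domain ∩ {p : Fin 1 → ℝ | p 0 < w} = e1 ⁻¹' Ioo (-1 : ℝ) w := by
    change oval 4 0 ∩ _ = _
    rw [oval_four_zero]
    ext p
    simp only [mem_inter_iff, mem_setOf_eq, mem_preimage, e1_apply, mem_Ioo]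
    constructor
    · rintro ⟨⟨h1, -⟩, h3⟩; exact ⟨h1, h3⟩
    · rintro ⟨h1, h3⟩; exact ⟨⟨h1, by linarith⟩, h3⟩
  have key := measurePreserving_e1.setIntegral_preimage_emb e1.measurableEmbedding
    (fun x : ℝ => x ^ m / Real.sqrt (cubic 4 0 x)) (Ioo (-1 : ℝ) w)
  simp only [e1_apply] at key
  rw [hset]
  change ∫ p in e1 ⁻¹' Ioo (-1 : ℝ) w, p 0 ^ m / Real.sqrt (cubic 4 0 (p 0)) = _
  rw [key, intervalIntegral.integral_of_le hw1, integral_Ioc_eq_integral_Ioo]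

end ModelCurve

end Summit.KontsevichZagierPeriods.HermiteRigidity.EllipticMomentKernelNegative
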